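import Literature.AlgebraicGeometry.HodgeTheory.AbelianVarietyEllipticCurveHomDualIsogeny
import HarnessLib

/-!
# The dual isogeny as an additive, degree-preserving, involutive bijection `Hom(E₁, E₂) ≅ Hom(E₂, E₁)` for complex elliptic curves; degree `1` ⇔ isomorphism; symmetry of isogeny degrees and of `rank Hom`; `†`-semilinearity over `End(E₁)`, `End(E₂)`

Layer `Literature/AlgebraicGeometry/HodgeTheory`, namespace `Literature.AlgebraicGeometry.HodgeTheory` (theorems in the `AbelianVariety` namespace).
THEOREMS ONLY (no definition, no named fact, no instance, no notation; D-0026 net debt 0).  Sequel of `AbelianVarietyEllipticCurveHomDualIsogeny`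
(g47-#1), which proves Silverman III.6.1–6.2 for `Hom(E₁, E₂)` over `ℂ` in hypothesis form on DUAL PAIRS `φ : E₁ ⟶ E₂`, `φ' : E₂ ⟶ E₁`,
`φ ≫ φ' = d(φ)·𝟙 E₁`, `d(φ') = d(φ)` (`d(φ) = |Ker φ(ℂ)| = Nat.card (Hom.kerPoints (specOver ℂ ℂ) φ)`).  Here the existence-and-uniqueness of the
dual is PACKAGED: Theorem 6.2 (c), (e), (f) say precisely that `φ ↦ φ̂` is an additive, degree-preserving bijection `Hom(E₁, E₂) → Hom(E₂, E₁)`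
whose inverse is `ψ ↦ ψ̂`, and this file produces that bijection as an `AddEquiv` INSIDE AN EXISTENTIAL STATEMENT (nothing is defined).

THE PRINTS (held `book:silverman1986-arithmetic-elliptic-curves`, read).  J. H. Silverman, *The Arithmetic of Elliptic Curves* [SilvermanAEC2009],
III §6 Thm. 6.1 (a) [p0079] («There exists a unique isogeny `φ̂ : E₂ → E₁` satisfying `φ̂ ∘ φ = [m]`»), Thm. 6.2 [p0080] («(c) `\widehat{φ + ψ} =
φ̂ + ψ̂` … (e) `deg φ̂ = deg φ`. (f) `φ̂̂ = φ`»); III §4 [p0068] Prop. 4.2 (b) («`Hom(E₁, E₂)` is a torsion-free `ℤ`-module») and III §7 Cor. 7.5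
(«`Hom(E₁, E₂)` is a free `ℤ`-module of rank at most `4`»); II §2 Cor. 2.4.1 [p0037] («Let `φ : C₁ → C₂` be a map of degree one between smooth
curves. Then `φ` is an isomorphism»).  H. Lange, *Abelian Varieties over the Complex Numbers* [Lange2023AbelianVarietiesComplex] §1.1.2
Prop. 1.1.13 (b) («`deg(gf) = deg f · deg g`»), Cor. 1.1.16 (a) («Isogenies define an equivalence relation»), §2.4 Lemma 2.4.1 (the Rosati
involution `f' = φ_L⁻¹ f̂ φ_L`; on `End(E)`: `α† = t(α)·𝟙 − α`, the tree's `AbelianVarietyEllipticCurveDualEndomorphism`).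

## What is proved (`E₁ E₂ : Motives.AbelianVariety ℂ` with `dim = 1`; `φ ψ : E₁ ⟶ E₂`, `φ' : E₂ ⟶ E₁`, `α : E₁ ⟶ E₁`, `β : E₂ ⟶ E₂`)

* §1 DEGREE ONE: **`natCard_kerPoints_eq_one_iff_isIso_of_dim_eq_one`** (`d(φ) = 1 ↔ φ` is an isomorphism; the inverse is the dual),
  `comp_eq_id_of_natCard_kerPoints_eq_one` (a dual pair of degree `1` is a pair of inverse isomorphisms);
  **`IsIsogeny.exists_isIsogeny_natCard_kerPoints_eq_of_dim_eq_one`** (SYMMETRY OF ISOGENY DEGREES: an isogeny `E₁ → E₂` of degree `m` yields an isogeny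
  `E₂ → E₁` of degree `m` — its dual), `exists_natCard_kerPoints_eq_iff_of_dim_eq_one` (`m` is the degree of some `E₁ → E₂` iff of some `E₂ → E₁`).
* §2 THE DUALITY BIJECTION: **`exists_addEquiv_forall_comp_eq_natCard_kerPoints_zsmul_id`** — there is an ADDITIVE EQUIVALENCE
  `D : Hom(E₁, E₂) ≃+ Hom(E₂, E₁)` with `φ ≫ D φ = d(φ)·𝟙`, `D φ ≫ φ = d(φ)·𝟙`, `d(D φ) = d(φ)` for all `φ`, whose inverse is the duality the other
  way (`ψ ≫ D⁻¹ ψ = d(ψ)·𝟙`, `d(D⁻¹ ψ) = d(ψ)`) — Thm. 6.2 (c), (e), (f) as one object; hence **`finrank_hom_comm_of_dim_eq_one`**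
  (`rank_ℤ Hom(E₁, E₂) = rank_ℤ Hom(E₂, E₁)`) and `nonempty_hom_linearEquiv_hom_of_dim_eq_one`.
* §3 `†`-SEMILINEARITY (Thm. 6.2 (b) with the dual endomorphism `α† = t(α)·𝟙 − α` of `AbelianVarietyEllipticCurveDualEndomorphism`):
  **`comp_comp_comp_trace_smul_id_sub_eq_natCard_kerPoints_zsmul_id`** (`(α ≫ φ, φ' ≫ α†)` is a dual pair: `\widehat{φ ∘ α} = α̂ ∘ φ̂`) and
  **`comp_comp_trace_smul_id_sub_comp_eq_natCard_kerPoints_zsmul_id`** (`(φ ≫ β, β† ≫ φ')` is a dual pair), each with its degree clause.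
* §4 COMPOSITION SCALES THE DEGREE FORM: `polar_natCard_kerPoints_comp_right_of_dim_eq_one` (`⟨φ ≫ χ, ψ ≫ χ⟩ = d(χ)·⟨φ, ψ⟩`),
  `polar_natCard_kerPoints_comp_left_of_dim_eq_one` (`⟨χ ≫ φ, χ ≫ ψ⟩ = d(χ)·⟨φ, ψ⟩`), `natCard_kerPoints_comp_add_comp_of_dim_eq_one`.

## SCOPE

Complex elliptic curves only; nothing is defined (the bijection lives inside `∃`); RULING-29-bis twins on other carriers as announced in
`AbelianVarietyEllipticCurveHomDualIsogeny` (torus level `Geometry/Kaehler/ComplexTorusEllipticCurveDualIsogeny`, Siegel family, Weierstrass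
equations) — neither imported nor restated.  Nothing here is a case of the Hodge conjecture.

## References

* [SilvermanAEC2009] J. H. Silverman, *The Arithmetic of Elliptic Curves*, 2nd ed., GTM 106, Springer 2009 — II §2 Cor. 2.4.1; III §4 Prop. 4.2 (b);
  III §6 Thm. 6.1 (a), Thm. 6.2 (b), (c), (e), (f); III §7 Cor. 7.5.
* [Lange2023AbelianVarietiesComplex] H. Lange, *Abelian Varieties over the Complex Numbers*, Springer 2023 — §1.1.2 Prop. 1.1.13 (b), Cor. 1.1.16;
  §2.4 Lemma 2.4.1.

## Provenance

lit-hodgefound prover seat p21, generation 47, row g47-#3 (own row, claimed by path; sequel of g47-#1 and g46-#10).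
-/

open Function CategoryTheory Module
open Literature.AlgebraicTopology.SingularHomology

universe u

namespace Literature.AlgebraicGeometry.HodgeTheory

namespace AbelianVariety

open _root_.AlgebraicGeometry
open Literature.AlgebraicGeometry.Motives
open Literature.AlgebraicGeometry.Motives.AbelianVariety
open scoped MonObj

section Elliptic

variable {E₁ E₂ : Motives.AbelianVariety ℂ} (h₁ : E₁.dim = 1) (h₂ : E₂.dim = 1)
include h₁ h₂

/-! ### §1 Degree one ⇔ isomorphism; symmetry of isogeny degrees -/

/-- **A dual pair of degree `1` is a pair of inverse isomorphisms**: `φ ≫ φ' = d(φ)·𝟙`, `d(φ) = 1 ⇒ φ ≫ φ' = 𝟙 ∧ φ' ≫ φ = 𝟙`.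
[cite: SilvermanAEC2009, III §6 Thm. 6.1 (a), Thm. 6.2 (a)] [cite: SilvermanAEC2009, II §2 Cor. 2.4.1] -/
theorem comp_eq_id_of_natCard_kerPoints_eq_one {φ : E₁ ⟶ E₂} {φ' : E₂ ⟶ E₁}
    (hφ : φ ≫ φ' = (Nat.card (Hom.kerPoints (specOver ℂ ℂ) φ) : ℤ) • 𝟙 E₁) (h1 : Nat.card (Hom.kerPoints (specOver ℂ ℂ) φ) = 1) :
    φ ≫ φ' = 𝟙 E₁ ∧ φ' ≫ φ = 𝟙 E₂ := by
  have hφ' := (comp_eq_natCard_kerPoints_zsmul_id_comm h₁ h₂ φ φ').1 hφ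
  rw [h1, Nat.cast_one, one_zsmul] at hφ hφ'
  exact ⟨hφ, hφ'⟩

/-- **`d(φ) = 1 ↔ φ` IS AN ISOMORPHISM** for `φ : E₁ ⟶ E₂` between complex elliptic curves («a map of degree one between smooth curves is an
isomorphism»; conversely `d(φ)·d(φ⁻¹) = d(𝟙) = 1`); the inverse of a degree-one `φ` is its dual. [cite: SilvermanAEC2009, II §2 Cor. 2.4.1 (p. 37)]
[cite: Lange2023AbelianVarietiesComplex, §1.1.2 Prop. 1.1.13 (b)] -/
theorem natCard_kerPoints_eq_one_iff_isIso_of_dim_eq_one (φ : E₁ ⟶ E₂) : Nat.card (Hom.kerPoints (specOver ℂ ℂ) φ) = 1 ↔ IsIso φ := by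
  constructor
  · intro h1
    obtain ⟨φ', hφ, -, -⟩ := exists_comp_eq_natCard_kerPoints_zsmul_id_of_dim_eq_one h₁ h₂ φ
    obtain ⟨h, h'⟩ := comp_eq_id_of_natCard_kerPoints_eq_one h₁ h₂ hφ h1
    exact ⟨φ', h, h'⟩
  · intro hφ
    have h := natCard_kerPoints_comp_of_dim_eq_one h₁ h₂ φ (inv φ)
    rw [IsIso.hom_inv_id, Hom.kerPoints_id, Subgroup.card_bot] at h
    exact Nat.eq_one_of_mul_eq_one_right h.symm

/-- **SYMMETRY OF ISOGENY DEGREES**: an isogeny `φ : E₁ → E₂` of degree `m` between complex elliptic curves yields an isogeny `E₂ → E₁` of the same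
degree `m` — its dual («`deg φ̂ = deg φ`»; compare the general-dimension reverse isogeny of degree `m^{2g−1}`).
[cite: SilvermanAEC2009, III §6 Thm. 6.1 (a) and Thm. 6.2 (e)] [cite: Lange2023AbelianVarietiesComplex, §1.1.2 Cor. 1.1.16 (a)] -/
theorem _root_.Literature.AlgebraicGeometry.Motives.AbelianVariety.IsIsogeny.exists_isIsogeny_natCard_kerPoints_eq_of_dim_eq_one {φ : E₁ ⟶ E₂}
    (hφ : IsIsogeny φ) : ∃ ψ : E₂ ⟶ E₁, IsIsogeny ψ ∧ Nat.card (Hom.kerPoints (specOver ℂ ℂ) ψ) = Nat.card (Hom.kerPoints (specOver ℂ ℂ) φ) := by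
  obtain ⟨φ', h, -, hd⟩ := exists_comp_eq_natCard_kerPoints_zsmul_id_of_dim_eq_one h₁ h₂ φ
  have hne : φ ≠ 0 := by
    intro h0
    have hp := hφ.natCard_kerPoints_pos
    rw [h0, natCard_kerPoints_zero_eq_zero (by omega)] at hp
    exact lt_irrefl 0 hp
  exact ⟨φ', isIsogeny_of_comp_eq_natCard_kerPoints_zsmul_id h₁ h₂ hne h, hd⟩

/-- **`m` is the degree of some homomorphism `E₁ → E₂` iff it is the degree of some homomorphism `E₂ → E₁`.** [cite: SilvermanAEC2009, III §6 Thm. 6.2 (e), (f)] -/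
theorem exists_natCard_kerPoints_eq_iff_of_dim_eq_one (m : ℕ) :
    (∃ φ : E₁ ⟶ E₂, Nat.card (Hom.kerPoints (specOver ℂ ℂ) φ) = m) ↔ ∃ ψ : E₂ ⟶ E₁, Nat.card (Hom.kerPoints (specOver ℂ ℂ) ψ) = m := by
  constructor
  · rintro ⟨φ, rfl⟩
    obtain ⟨φ', -, -, hd⟩ := exists_comp_eq_natCard_kerPoints_zsmul_id_of_dim_eq_one h₁ h₂ φ
    exact ⟨φ', hd⟩
  · rintro ⟨ψ, rfl⟩
    obtain ⟨ψ', -, -, hd⟩ := exists_comp_eq_natCard_kerPoints_zsmul_id_of_dim_eq_one h₂ h₁ ψ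
    exact ⟨ψ', hd⟩

/-! ### §2 The duality bijection `Hom(E₁, E₂) ≃+ Hom(E₂, E₁)` -/

/-- **THE DUAL ISOGENY IS AN ADDITIVE, DEGREE-PRESERVING, INVOLUTIVE BIJECTION `Hom(E₁, E₂) ≅ Hom(E₂, E₁)`** for complex elliptic curves: there is
`D : Hom(E₁, E₂) ≃+ Hom(E₂, E₁)` with `φ ≫ D φ = d(φ)·𝟙 E₁`, `D φ ≫ φ = d(φ)·𝟙 E₂`, `d(D φ) = d(φ)` for every `φ`, and whose inverse is the duality
`Hom(E₂, E₁) → Hom(E₁, E₂)` (`ψ ≫ D⁻¹ ψ = d(ψ)·𝟙 E₂`, `d(D⁻¹ ψ) = d(ψ)`) — Theorem 6.1 (a) (existence, uniqueness) with Theorem 6.2 (c) (additivity),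
(e) (degrees), (f) (`φ̂̂ = φ`, so `ψ ↦ ψ̂` is the inverse). [cite: SilvermanAEC2009, III §6 Thm. 6.1 (a) (p. 79) and Thm. 6.2 (c), (e), (f) (pp. 80–82)] -/
theorem exists_addEquiv_forall_comp_eq_natCard_kerPoints_zsmul_id :
    ∃ D : (E₁ ⟶ E₂) ≃+ (E₂ ⟶ E₁),
      (∀ φ : E₁ ⟶ E₂, φ ≫ D φ = (Nat.card (Hom.kerPoints (specOver ℂ ℂ) φ) : ℤ) • 𝟙 E₁ ∧
          D φ ≫ φ = (Nat.card (Hom.kerPoints (specOver ℂ ℂ) φ) : ℤ) • 𝟙 E₂ ∧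
          Nat.card (Hom.kerPoints (specOver ℂ ℂ) (D φ)) = Nat.card (Hom.kerPoints (specOver ℂ ℂ) φ)) ∧
        ∀ ψ : E₂ ⟶ E₁, ψ ≫ D.symm ψ = (Nat.card (Hom.kerPoints (specOver ℂ ℂ) ψ) : ℤ) • 𝟙 E₂ ∧
          D.symm ψ ≫ ψ = (Nat.card (Hom.kerPoints (specOver ℂ ℂ) ψ) : ℤ) • 𝟙 E₁ ∧
          Nat.card (Hom.kerPoints (specOver ℂ ℂ) (D.symm ψ)) = Nat.card (Hom.kerPoints (specOver ℂ ℂ) ψ) := by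
  choose D hD hD' hDd using exists_comp_eq_natCard_kerPoints_zsmul_id_of_dim_eq_one h₁ h₂
  choose D' hD₂ hD₂' hD₂d using exists_comp_eq_natCard_kerPoints_zsmul_id_of_dim_eq_one h₂ h₁
  -- `D' (D φ) = φ`: both `D' (D φ)` and `φ` are duals of `D φ`
  have hleft : ∀ φ, D' (D φ) = φ := fun φ ↦
    eq_of_comp_eq_natCard_kerPoints_zsmul_id h₂ h₁ (hD₂ (D φ)) (hD₂d (D φ))
      (comp_eq_natCard_kerPoints_zsmul_id_swap h₁ h₂ (hD φ) (hDd φ)) (hDd φ).symm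
  have hright : ∀ ψ, D (D' ψ) = ψ := fun ψ ↦
    eq_of_comp_eq_natCard_kerPoints_zsmul_id h₁ h₂ (hD (D' ψ)) (hDd (D' ψ))
      (comp_eq_natCard_kerPoints_zsmul_id_swap h₂ h₁ (hD₂ ψ) (hD₂d ψ)) (hD₂d ψ).symm
  -- additivity: `D φ + D ψ` is a dual of `φ + ψ` (Thm. 6.2 (c))
  have hadd : ∀ φ ψ, D (φ + ψ) = D φ + D ψ := fun φ ψ ↦
    eq_of_comp_eq_natCard_kerPoints_zsmul_id h₁ h₂ (hD (φ + ψ)) (hDd (φ + ψ))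
      (add_comp_add_eq_natCard_kerPoints_zsmul_id h₁ h₂ (hD φ) (hDd φ) (hD ψ) (hDd ψ))
      (natCard_kerPoints_add_eq_of_comp_eq_natCard_kerPoints_zsmul_id h₁ h₂ (hD φ) (hDd φ) (hD ψ) (hDd ψ))
  refine ⟨{ toFun := D, invFun := D', left_inv := hleft, right_inv := hright, map_add' := hadd }, fun φ ↦ ⟨hD φ, hD' φ, hDd φ⟩,
    fun ψ ↦ ⟨hD₂ ψ, hD₂' ψ, hD₂d ψ⟩⟩

/-- **`Hom(E₁, E₂) ≅ Hom(E₂, E₁)` as `ℤ`-modules** (the duality bijection is `ℤ`-linear). [cite: SilvermanAEC2009, III §6 Thm. 6.2 (c), (f)]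
[cite: SilvermanAEC2009, III §7 Cor. 7.5] -/
theorem nonempty_hom_linearEquiv_hom_of_dim_eq_one : Nonempty ((E₁ ⟶ E₂) ≃ₗ[ℤ] (E₂ ⟶ E₁)) := by
  obtain ⟨D, -, -⟩ := exists_addEquiv_forall_comp_eq_natCard_kerPoints_zsmul_id h₁ h₂
  exact ⟨D.toIntLinearEquiv⟩

/-- **`rank_ℤ Hom(E₁, E₂) = rank_ℤ Hom(E₂, E₁)`** for complex elliptic curves (the duality bijection is a `ℤ`-linear isomorphism).
[cite: SilvermanAEC2009, III §6 Thm. 6.2 (c), (f) and III §7 Cor. 7.5] -/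
theorem finrank_hom_comm_of_dim_eq_one : Module.finrank ℤ (E₁ ⟶ E₂) = Module.finrank ℤ (E₂ ⟶ E₁) := by
  obtain ⟨e⟩ := nonempty_hom_linearEquiv_hom_of_dim_eq_one h₁ h₂
  exact e.finrank_eq

/-! ### §3 `†`-semilinearity: `\widehat{φ ∘ α} = α† ∘ φ̂` and `\widehat{β ∘ φ} = φ̂ ∘ β†` -/

omit h₂ in
/-- Plumbing: the dual endomorphism `α† = t(α)·𝟙 − α` of `AbelianVarietyEllipticCurveDualEndomorphism` satisfies the dual relation in kernel-count form,
`α ≫ α† = d(α)·𝟙` and `d(α†) = d(α)`. [cite: SilvermanAEC2009, III §6 Thm. 6.2 (a), (e)] [cite: Lange2023AbelianVarietiesComplex, §1.1.2 Prop. 1.1.13 (c)] -/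
theorem comp_trace_smul_id_sub_self_eq_natCard_kerPoints_zsmul_id (α : E₁ ⟶ E₁) :
    α ≫ (LinearMap.trace ℤ _ (singularCohomology.map ℤ ℤ (AlgPoints.mapContinuous (L := ℂ) α.hom.hom.hom) 1).hom • 𝟙 E₁ - α) =
        (Nat.card (Hom.kerPoints (specOver ℂ ℂ) α) : ℤ) • 𝟙 E₁ ∧
      Nat.card (Hom.kerPoints (specOver ℂ ℂ)
          (LinearMap.trace ℤ _ (singularCohomology.map ℤ ℤ (AlgPoints.mapContinuous (L := ℂ) α.hom.hom.hom) 1).hom • 𝟙 E₁ - α)) =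
        Nat.card (Hom.kerPoints (specOver ℂ ℂ) α) := by
  refine ⟨?_, natCard_kerPoints_trace_smul_id_sub h₁ α⟩
  rw [comp_trace_smul_id_sub_self h₁ α, natCard_kerPoints_eq_det_singularCohomology_map_one]

/-- **`\widehat{φ ∘ α} = α† ∘ φ̂` — SEMILINEARITY OF THE DUAL OVER `End(E₁)`**: for a dual pair `(φ, φ')` on `Hom(E₁, E₂)` and `α ∈ End(E₁)`,
`(α ≫ φ, φ' ≫ α†)` is a dual pair, `α† = t(α)·𝟙 − α` (Thm. 6.2 (b) with the dual endomorphism; the Rosati involution is an anti-involution).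
[cite: SilvermanAEC2009, III §6 Thm. 6.2 (b) (p. 81)] [cite: Lange2023AbelianVarietiesComplex, §2.4 Lemma 2.4.1 and Thm. 2.4.5 (a) («`(fg)' = g'f'`»)] -/
theorem comp_comp_comp_trace_smul_id_sub_eq_natCard_kerPoints_zsmul_id (α : E₁ ⟶ E₁) {φ : E₁ ⟶ E₂} {φ' : E₂ ⟶ E₁}
    (hφ : φ ≫ φ' = (Nat.card (Hom.kerPoints (specOver ℂ ℂ) φ) : ℤ) • 𝟙 E₁)
    (hφd : Nat.card (Hom.kerPoints (specOver ℂ ℂ) φ') = Nat.card (Hom.kerPoints (specOver ℂ ℂ) φ)) :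
    (α ≫ φ) ≫ (φ' ≫ (LinearMap.trace ℤ _ (singularCohomology.map ℤ ℤ (AlgPoints.mapContinuous (L := ℂ) α.hom.hom.hom) 1).hom • 𝟙 E₁ - α)) =
        (Nat.card (Hom.kerPoints (specOver ℂ ℂ) (α ≫ φ)) : ℤ) • 𝟙 E₁ ∧
      Nat.card (Hom.kerPoints (specOver ℂ ℂ)
          (φ' ≫ (LinearMap.trace ℤ _ (singularCohomology.map ℤ ℤ (AlgPoints.mapContinuous (L := ℂ) α.hom.hom.hom) 1).hom • 𝟙 E₁ - α))) =
        Nat.card (Hom.kerPoints (specOver ℂ ℂ) (α ≫ φ)) := by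
  obtain ⟨hα, hαd⟩ := comp_trace_smul_id_sub_self_eq_natCard_kerPoints_zsmul_id h₁ α
  exact ⟨comp_comp_comp_eq_natCard_kerPoints_zsmul_id h₁ h₁ hα hφ,
    natCard_kerPoints_comp_eq_of_comp_eq_natCard_kerPoints_zsmul_id h₁ h₁ h₂ hαd hφd⟩

/-- **`\widehat{β ∘ φ} = φ̂ ∘ β†` — SEMILINEARITY OF THE DUAL OVER `End(E₂)`**: for a dual pair `(φ, φ')` on `Hom(E₁, E₂)` and `β ∈ End(E₂)`,
`(φ ≫ β, β† ≫ φ')` is a dual pair, `β† = t(β)·𝟙 − β`. [cite: SilvermanAEC2009, III §6 Thm. 6.2 (b) (p. 81)]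
[cite: Lange2023AbelianVarietiesComplex, §2.4 Lemma 2.4.1 and Thm. 2.4.5 (a)] -/
theorem comp_comp_trace_smul_id_sub_comp_eq_natCard_kerPoints_zsmul_id (β : E₂ ⟶ E₂) {φ : E₁ ⟶ E₂} {φ' : E₂ ⟶ E₁}
    (hφ : φ ≫ φ' = (Nat.card (Hom.kerPoints (specOver ℂ ℂ) φ) : ℤ) • 𝟙 E₁)
    (hφd : Nat.card (Hom.kerPoints (specOver ℂ ℂ) φ') = Nat.card (Hom.kerPoints (specOver ℂ ℂ) φ)) :
    (φ ≫ β) ≫ ((LinearMap.trace ℤ _ (singularCohomology.map ℤ ℤ (AlgPoints.mapContinuous (L := ℂ) β.hom.hom.hom) 1).hom • 𝟙 E₂ - β) ≫ φ') =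
        (Nat.card (Hom.kerPoints (specOver ℂ ℂ) (φ ≫ β)) : ℤ) • 𝟙 E₁ ∧
      Nat.card (Hom.kerPoints (specOver ℂ ℂ)
          ((LinearMap.trace ℤ _ (singularCohomology.map ℤ ℤ (AlgPoints.mapContinuous (L := ℂ) β.hom.hom.hom) 1).hom • 𝟙 E₂ - β) ≫ φ')) =
        Nat.card (Hom.kerPoints (specOver ℂ ℂ) (φ ≫ β)) := by
  obtain ⟨hβ, hβd⟩ := comp_trace_smul_id_sub_self_eq_natCard_kerPoints_zsmul_id h₂ β
  exact ⟨comp_comp_comp_eq_natCard_kerPoints_zsmul_id h₁ h₂ hφ hβ,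
    natCard_kerPoints_comp_eq_of_comp_eq_natCard_kerPoints_zsmul_id h₂ h₁ h₂ hφd hβd⟩

/-! ### §4 Composition scales the degree form: `⟨φ ≫ χ, ψ ≫ χ⟩ = d(χ)·⟨φ, ψ⟩`, `⟨χ ≫ φ, χ ≫ ψ⟩ = d(χ)·⟨φ, ψ⟩` -/

variable {E₀ E₃ : Motives.AbelianVariety ℂ}

/-- **`⟨φ ≫ χ, ψ ≫ χ⟩ = d(χ) · ⟨φ, ψ⟩`**: composing with `χ : E₂ ⟶ E₃` on the right multiplies Silverman's pairing `⟨φ, ψ⟩ = d(φ + ψ) − d(φ) − d(ψ)` on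
`Hom(E₁, E₂)` by `d(χ)` (`deg` is multiplicative and `(φ + ψ) ≫ χ = φ ≫ χ + ψ ≫ χ`). [cite: SilvermanAEC2009, III §6 Cor. 6.3 (p. 82)]
[cite: Lange2023AbelianVarietiesComplex, §1.1.2 Prop. 1.1.13 (b)] -/
theorem polar_natCard_kerPoints_comp_right_of_dim_eq_one (χ : E₂ ⟶ E₃) (φ ψ : E₁ ⟶ E₂) :
    (Nat.card (Hom.kerPoints (specOver ℂ ℂ) (φ ≫ χ + ψ ≫ χ)) : ℤ) - Nat.card (Hom.kerPoints (specOver ℂ ℂ) (φ ≫ χ)) -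
        Nat.card (Hom.kerPoints (specOver ℂ ℂ) (ψ ≫ χ)) =
      Nat.card (Hom.kerPoints (specOver ℂ ℂ) χ) *
        ((Nat.card (Hom.kerPoints (specOver ℂ ℂ) (φ + ψ)) : ℤ) - Nat.card (Hom.kerPoints (specOver ℂ ℂ) φ) - Nat.card (Hom.kerPoints (specOver ℂ ℂ) ψ)) := by
  rw [← Preadditive.add_comp, natCard_kerPoints_comp_of_dim_eq_one h₁ h₂ (φ + ψ) χ, natCard_kerPoints_comp_of_dim_eq_one h₁ h₂ φ χ,
    natCard_kerPoints_comp_of_dim_eq_one h₁ h₂ ψ χ]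
  push_cast
  ring

omit h₂ in
/-- **`⟨χ ≫ φ, χ ≫ ψ⟩ = d(χ) · ⟨φ, ψ⟩`**: composing with `χ : E₀ ⟶ E₁` on the left multiplies the pairing on `Hom(E₁, E₂)` by `d(χ)`.
[cite: SilvermanAEC2009, III §6 Cor. 6.3 (p. 82)] [cite: Lange2023AbelianVarietiesComplex, §1.1.2 Prop. 1.1.13 (b)] -/
theorem polar_natCard_kerPoints_comp_left_of_dim_eq_one (h₀ : E₀.dim = 1) (χ : E₀ ⟶ E₁) (φ ψ : E₁ ⟶ E₂) :
    (Nat.card (Hom.kerPoints (specOver ℂ ℂ) (χ ≫ φ + χ ≫ ψ)) : ℤ) - Nat.card (Hom.kerPoints (specOver ℂ ℂ) (χ ≫ φ)) -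
        Nat.card (Hom.kerPoints (specOver ℂ ℂ) (χ ≫ ψ)) =
      Nat.card (Hom.kerPoints (specOver ℂ ℂ) χ) *
        ((Nat.card (Hom.kerPoints (specOver ℂ ℂ) (φ + ψ)) : ℤ) - Nat.card (Hom.kerPoints (specOver ℂ ℂ) φ) - Nat.card (Hom.kerPoints (specOver ℂ ℂ) ψ)) := by
  rw [← Preadditive.comp_add, natCard_kerPoints_comp_of_dim_eq_one h₀ h₁ χ (φ + ψ), natCard_kerPoints_comp_of_dim_eq_one h₀ h₁ χ φ,
    natCard_kerPoints_comp_of_dim_eq_one h₀ h₁ χ ψ]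
  push_cast
  ring

/-- **`d(φ ≫ χ + ψ ≫ χ) = d(χ)·d(φ + ψ)`**: the degree form on `Hom(E₁, E₂)` composed with `χ` is `d(χ)` times the degree form.
[cite: Lange2023AbelianVarietiesComplex, §1.1.2 Prop. 1.1.13 (b)] [cite: SilvermanAEC2009, III §6 Cor. 6.3] -/
theorem natCard_kerPoints_comp_add_comp_of_dim_eq_one (χ : E₂ ⟶ E₃) (φ ψ : E₁ ⟶ E₂) :
    Nat.card (Hom.kerPoints (specOver ℂ ℂ) (φ ≫ χ + ψ ≫ χ)) =
      Nat.card (Hom.kerPoints (specOver ℂ ℂ) (φ + ψ)) * Nat.card (Hom.kerPoints (specOver ℂ ℂ) χ) := by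
  rw [← Preadditive.add_comp, natCard_kerPoints_comp_of_dim_eq_one h₁ h₂ (φ + ψ) χ]

end Elliptic

end AbelianVariety

end Literature.AlgebraicGeometry.HodgeTheory
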